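import Mathlib
import Summits.KontsevichZagierPeriods.Zeta5Search.DenomLaw.KummerOctaveOne
import HarnessLib

/-!
# ζ(5) search — KUMMER AT OCTAVE ONE, part 2: the CENTRE class of the symmetric cells `b₀ = 2x + p`

Cell `pub-zeta5`, track DENOM-LAW (D1 prover, denom-prover-d1 g4).  HONEST FRAMING: systematic search; `p`-adic valuations of the
cell's own class sums `V_x`, `W_x` (rational numbers); worth on the census rays 0; nothing about ζ(5); no irrationality claim; records
in print UNMOVED.  Companion of `DenomLaw/KummerOctaveOne.lean` (centre-free two-level classes): here the one configuration its level
lemmas exclude — the class `{x, x + p}` of a cell with `b₀ = 2x + p`, which contains the odd centre at the half-level `½` (theory-d1 g6's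
symmetric family `S(1,p,r) = (p + 2r; r⁷)`, engine-d2's witness `(9; 1⁷)` at `p = 7`).  Its class function is `(η − ½)η^{−6}(η − 1)^{−6}`,
with digits `ŵ = −14`, `v̂ = 21` for every `p` (`wHat_centre`, `vHat_centre`, evaluated from `classCofactor` by the computable mirror
`TypeEval`); at `p = 7` both vanish mod `p`, whence `v₇(V_x) ≥ E_x + 1 = −10` and `v₇(W_x) ≥ E_x + 4 = −7` (`kummer7_centre_classV/W`,
via `CellA.vDigit` / `CellA.wDigit`) — exactly the observed `v₇(V(9;1⁷)) = −10 = VB⁺ + 1`, `v₇(W) = −7` of C-D2-20's octave-1 entry.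
-/

noncomputable section

open Finset

namespace Summit.KontsevichZagierPeriods.Zeta5Search.KummerOctaveOne

open Summit.KontsevichZagierPeriods.Zeta5Search.CasoratianValuation (InPolytope)
open Summit.KontsevichZagierPeriods.Zeta5Search.ClusterValuation
open Summit.KontsevichZagierPeriods.Zeta5Search.CellA (classW small_add small_mul)
open Summit.KontsevichZagierPeriods.Zeta5Search.LevelClass

variable {p : ℕ} [hp : Fact p.Prime]

/-! ## §5 The CENTRE class of the symmetric octave-one cells (`b₀ = 2x + p`): type `(−6,−6)` with the odd centre at level `½`

On `b₀ = 2x + p` the class `{x, x+p}` contains the (half-integer) centre: `CentreIn b p x`, so the level lemmas of `LevelClassDigits` do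
not apply; the class function is `Φ(η) = (η − ½)·η^{−6}(η−1)^{−6}` and its digits are `ŵ = −14`, `v̂ = 21` for EVERY `p` (theory-d1 g6's
octave constants `ŵ₁`, `v̂₁`).  We evaluate `wHat` / `vHat` from the definitions (`classCofactor` with its centre factor) by the computable
mirror and conclude at `p = 7` with `CellA.wDigit` / `CellA.vDigit` directly. -/

section Centre

open Summit.KontsevichZagierPeriods.Zeta5Search.CellA (vDigit wDigit)
open Summit.KontsevichZagierPeriods.Zeta5Search.TypeEval (binomC prodCL getD_prodCL binomSeries_eq_mk)
open Literature.NumberTheory.Transcendental.BallRivoal (harm)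

variable (b : ℕ → ℤ) {x : ℕ} (hx : x < p) (hb0 : b 0 = 2 * (x : ℤ) + p)

include hx hb0 in
/-- The class of `x` is `{x, x + p}`. -/
theorem classSet_centre : classSet b p x = {x, x + p} := by
  have h1 : x + 1 * p ≤ (b 0).toNat := by rw [hb0]; omega
  have h1' : (b 0).toNat < x + 1 * p + p := by rw [hb0]; omega
  rw [classSet_level b hx h1 h1']
  ext s
  simp only [mem_image, mem_range, mem_insert, mem_singleton]
  constructor
  · rintro ⟨k, hk, rfl⟩
    interval_cases k
    · left; simp
    · right; simp
  · rintro (rfl | rfl)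
    · exact ⟨0, by omega, by simp⟩
    · exact ⟨1, by omega, by simp⟩

omit hp in
/-- The class of `x + p` is the class of `x`. -/
theorem classSet_shift : classSet b p (x + p) = classSet b p x := by
  unfold classSet
  simp only [Nat.add_mod_right]

include hb0 in
/-- `b₀` is odd (as `p` is an odd prime `≥ 3`; we assume `p ≠ 2`). -/
theorem b0_odd (hp2 : p ≠ 2) : ¬ (2 : ℤ) ∣ b 0 := by
  rw [hb0]
  intro h
  have hpodd : Odd p := hp.out.odd_of_ne_two hp2
  obtain ⟨k, hk⟩ := hpodd
  omega

include hb0 in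
omit hp in
/-- The centre lies in the class of `x`. -/
theorem centreIn_low : CentreIn b p x := by
  unfold CentreIn; rw [hb0]; exact ⟨-1, by ring⟩

include hb0 in
omit hp in
/-- The centre lies in the class of `x + p`. -/
theorem centreIn_high : CentreIn b p (x + p) := by
  unfold CentreIn; rw [hb0]; push_cast; exact ⟨1, by ring⟩

/-- The cofactor data at the lower point: `G_x(ε) = (ε − 1)^{−6}(ε − ½)`. -/
def cofLow : List (ℕ → ℚ) := [binomC (-1) (-6), binomC (-1 / 2) 1]
/-- The cofactor data at the upper point: `G_{x+p}(ε) = (ε + 1)^{−6}(ε + ½)`. -/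
def cofHigh : List (ℕ → ℚ) := [binomC 1 (-6), binomC (1 / 2) 1]

include hx hb0 in
/-- `classCofactor b p x = (ε − 1)^{−6}(ε − ½)` as a list product of `mk`'s. -/
theorem classCofactor_low (hp2 : p ≠ 2) (he1 : netExp b (x + p) = -6) :
    classCofactor b p x = (cofLow.map fun f => PowerSeries.mk f).prod := by
  have hp0 : (p : ℚ) ≠ 0 := Nat.cast_ne_zero.2 hp.out.ne_zero
  have hne : x ∉ ({x + p} : Finset ℕ) := by simp [hp.out.ne_zero]
  unfold classCofactor
  rw [classSet_centre b hx hb0, erase_insert hne, prod_singleton, he1,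
    if_pos ⟨b0_odd b hb0 hp2, centreIn_low b hb0⟩]
  have e1 : ((x : ℚ) - ((x + p : ℕ) : ℚ)) / p = -1 := by push_cast; field_simp; ring
  have e2 : ((x : ℚ) - ((b 0 : ℤ) : ℚ) / 2) / p = -1 / 2 := by rw [hb0]; push_cast; field_simp; ring
  rw [e1, e2, binomSeries_eq_mk, binomSeries_eq_mk]
  simp [cofLow]

include hx hb0 in
/-- `classCofactor b p (x + p) = (ε + 1)^{−6}(ε + ½)`. -/
theorem classCofactor_high (hp2 : p ≠ 2) (he0 : netExp b x = -6) :
    classCofactor b p (x + p) = (cofHigh.map fun f => PowerSeries.mk f).prod := by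
  have hp0 : (p : ℚ) ≠ 0 := Nat.cast_ne_zero.2 hp.out.ne_zero
  have hne : x + p ≠ x := by have := hp.out.ne_zero; omega
  unfold classCofactor
  rw [classSet_shift, classSet_centre b hx hb0, pair_comm, erase_insert (by simpa using hne), prod_singleton, he0,
    if_pos ⟨b0_odd b hb0 hp2, centreIn_high b hb0⟩]
  have e1 : (((x + p : ℕ) : ℚ) - (x : ℚ)) / p = 1 := by push_cast; field_simp; ring
  have e2 : (((x + p : ℕ) : ℚ) - ((b 0 : ℤ) : ℚ) / 2) / p = 1 / 2 := by rw [hb0]; push_cast; field_simp; ring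
  rw [e1, e2, binomSeries_eq_mk, binomSeries_eq_mk]
  simp [cofHigh]

include hx hb0 in
/-- `ρ_{x,σ} = [ε^{6−σ}] G_x`, computably. -/
theorem classRho_low (hp2 : p ≠ 2) (he0 : netExp b x = -6) (he1 : netExp b (x + p) = -6) (σ : ℕ) :
    classRho b p x σ = (prodCL (6 - σ) cofLow).getD (6 - σ) 0 := by
  unfold classRho
  rw [classCofactor_low b hx hb0 hp2 he1, he0, getD_prodCL _ _ le_rfl]
  rfl

include hx hb0 in
/-- `ρ_{x+p,σ} = [ε^{6−σ}] G_{x+p}`, computably. -/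
theorem classRho_high (hp2 : p ≠ 2) (he0 : netExp b x = -6) (he1 : netExp b (x + p) = -6) (σ : ℕ) :
    classRho b p (x + p) σ = (prodCL (6 - σ) cofHigh).getD (6 - σ) 0 := by
  unfold classRho
  rw [classCofactor_high b hx hb0 hp2 he0, he1, getD_prodCL _ _ le_rfl]
  rfl

include hx hb0 in
/-- The poles of the class: both points. -/
theorem classPoles_centre (he0 : netExp b x = -6) (he1 : netExp b (x + p) = -6) : CellA.classPoles b p x = {x, x + p} := by
  unfold CellA.classPoles
  rw [classSet_centre b hx hb0]
  ext s
  simp only [mem_filter, mem_insert, mem_singleton]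
  constructor
  · exact fun h => h.1
  · rintro (rfl | rfl)
    · exact ⟨Or.inl rfl, by rw [he0]; norm_num⟩
    · exact ⟨Or.inr rfl, by rw [he1]; norm_num⟩

include hx hb0 in
/-- **`ŵ_x = −14`** on the centre class. -/
theorem wHat_centre (hp2 : p ≠ 2) (he0 : netExp b x = -6) (he1 : netExp b (x + p) = -6) : CellA.wHat b p x = -14 := by
  have hne : x ∉ ({x + p} : Finset ℕ) := by simp [hp.out.ne_zero]
  unfold CellA.wHat
  rw [classPoles_centre b hx hb0 he0 he1, sum_insert hne, sum_singleton, he0, he1, if_pos (by norm_num), if_pos (by norm_num),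
    classRho_low b hx hb0 hp2 he0 he1, classRho_high b hx hb0 hp2 he0 he1]
  decide +kernel

include hx hb0 in
/-- **`v̂_x = 21`** on the centre class (the lower point is at level `0`: `H^{(σ)}_0 = 0`; the upper at level `1`: `H^{(σ)}_1 = 1`). -/
theorem vHat_centre (hp2 : p ≠ 2) (he0 : netExp b x = -6) (he1 : netExp b (x + p) = -6) : CellA.vHat b p x = 21 := by
  have hne : x ∉ ({x + p} : Finset ℕ) := by simp [hp.out.ne_zero]
  have hl0 : x / p = 0 := Nat.div_eq_of_lt hx
  have hl1 : (x + p) / p = 1 := by rw [Nat.add_div_right _ hp.out.pos, hl0]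
  have hh0 : ∀ σ, harm σ 0 = 0 := fun σ => by simp [harm]
  have hh1 : ∀ σ, harm σ 1 = 1 := fun σ => by simp [harm]
  unfold CellA.vHat
  rw [classPoles_centre b hx hb0 he0 he1, sum_insert hne, sum_singleton, hl0, hl1, he0, he1]
  simp only [hh0, hh1, mul_zero, sum_const_zero, zero_add, mul_one]
  rw [sum_congr rfl fun σ _ => by rw [classRho_high b hx hb0 hp2 he0 he1]]
  decide +kernel

include hx hb0 in
/-- The class exponent of the centre class: `E_x = −6 − 6 + 1 = −11`. -/
theorem classExp_centre (hp2 : p ≠ 2) (he0 : netExp b x = -6) (he1 : netExp b (x + p) = -6) : classExp b p x = -11 := by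
  have hne : x ∉ ({x + p} : Finset ℕ) := by simp [hp.out.ne_zero]
  unfold classExp
  rw [classSet_centre b hx hb0, sum_insert hne, sum_singleton, he0, he1, if_pos ⟨b0_odd b hb0 hp2, centreIn_low b hb0⟩]
  norm_num

/-- **KUMMER AT OCTAVE ONE, centre class, `V`: `v₇(V_x) ≥ −10 = E_x + 1`** on every cell with `b₀ = 2x + 7`, `x < 7`, both class points
full poles (e.g. `b = (9; 1⁷)`, `x = 1`: engine-d2's smallest witness of C-D2-20 octave 1, `v₇(V) = −10` vs `VB⁺ = −11`). -/
theorem kummer7_centre_classV (b : ℕ → ℤ) {x : ℕ} (hb : InPolytope b) (hwin : (b 0 + 2 : ℤ) < (7 : ℤ) ^ 2) (hx : x < 7)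
    (hb0 : b 0 = 2 * (x : ℤ) + 7) (he0 : netExp b x = -6) (he1 : netExp b (x + 7) = -6) (hne : classV b 7 x ≠ 0) :
    -10 ≤ padicValRat 7 (classV b 7 x) := by
  haveI : Fact (Nat.Prime 7) := ⟨by norm_num⟩
  have hxm : x ∈ classSet b 7 x := by rw [classSet_centre b hx hb0]; exact mem_insert_self _ _
  have hE := classExp_centre (p := 7) b hx hb0 (by norm_num) he0 he1
  have hv := vHat_centre (p := 7) b hx hb0 (by norm_num) he0 he1
  have hg1 : padicNorm 7 (gHat b 7 x) ≤ 1 := padicNorm_gHat_le_one b hb (by norm_num) hx hxm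
  have hD : padicNorm 7 (classV b 7 x - (-(7 : ℚ)) ^ classExp b 7 x * gHat b 7 x * CellA.vHat b 7 x) ≤ (7 : ℚ) ^ (-(classExp b 7 x + 1)) :=
    padicNorm_le_of_val fun h => by
      have := vDigit b 7 x x hb (by norm_num) (by norm_num) hwin hx hxm (by rw [he0]; norm_num) h
      exact_mod_cast this
  rw [hE, hv] at hD
  have hM : padicNorm 7 ((-(7 : ℚ)) ^ (-11 : ℤ) * gHat b 7 x * 21) ≤ (7 : ℚ) ^ (-(-11 + 1 : ℤ)) := by
    have hz : ∀ a : ℤ, padicNorm 7 ((-(7 : ℚ)) ^ a) = (7 : ℚ) ^ (-a) := fun a => by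
      have h := LevelClass.padicNorm_neg_p_zpow (p := 7) a
      exact_mod_cast h
    rw [padicNorm.mul, padicNorm.mul, hz]
    have h21 : padicNorm 7 (21 : ℚ) ≤ (7 : ℚ) ^ (-(1 : ℤ)) := by
      exact_mod_cast padicNorm_intCast_le_of_dvd (p := 7) (n := 21) (by norm_num)
    calc (7 : ℚ) ^ (-(-11 : ℤ)) * padicNorm 7 (gHat b 7 x) * padicNorm 7 21
        ≤ (7 : ℚ) ^ (-(-11 : ℤ)) * 1 * (7 : ℚ) ^ (-(1 : ℤ)) :=
          mul_le_mul (mul_le_mul_of_nonneg_left hg1 (by positivity)) h21 (padicNorm.nonneg _) (by positivity)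
      _ = (7 : ℚ) ^ (-(-11 + 1 : ℤ)) := by norm_num
  have hsplit : classV b 7 x = (classV b 7 x - (-(7 : ℚ)) ^ (-11 : ℤ) * gHat b 7 x * 21) +
      (-(7 : ℚ)) ^ (-11 : ℤ) * gHat b 7 x * 21 := by ring
  refine val_ge_of_padicNorm_le hne ?_
  rw [hsplit]
  refine (padicNorm.nonarchimedean (p := 7)).trans (max_le ?_ ?_)
  · exact_mod_cast hD
  · exact_mod_cast hM

/-- **KUMMER AT OCTAVE ONE, centre class, `W`: `v₇(W_x) ≥ −7 = E_x + 4`** (generic `E_x + 3 = −8`; on `(9;1⁷)`: `v₇(W) = −7`). -/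
theorem kummer7_centre_classW (b : ℕ → ℤ) {x : ℕ} (hb : InPolytope b) (hwin : (b 0 + 2 : ℤ) < (7 : ℤ) ^ 2) (hx : x < 7)
    (hb0 : b 0 = 2 * (x : ℤ) + 7) (he0 : netExp b x = -6) (he1 : netExp b (x + 7) = -6) (hne : classW b 7 x ≠ 0) :
    -7 ≤ padicValRat 7 (classW b 7 x) := by
  haveI : Fact (Nat.Prime 7) := ⟨by norm_num⟩
  have hxm : x ∈ classSet b 7 x := by rw [classSet_centre b hx hb0]; exact mem_insert_self _ _
  have hE := classExp_centre (p := 7) b hx hb0 (by norm_num) he0 he1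
  have hw := wHat_centre (p := 7) b hx hb0 (by norm_num) he0 he1
  have hg1 : padicNorm 7 (gHat b 7 x) ≤ 1 := padicNorm_gHat_le_one b hb (by norm_num) hx hxm
  have hD : padicNorm 7 (classW b 7 x - (-(7 : ℚ)) ^ (classExp b 7 x + 3) * gHat b 7 x * CellA.wHat b 7 x) ≤
      (7 : ℚ) ^ (-(classExp b 7 x + 4)) :=
    padicNorm_le_of_val fun h => by
      have := wDigit b 7 x x hb (by norm_num) (by norm_num) hwin hx hxm (by rw [he0]; norm_num) h
      exact_mod_cast this
  rw [hE, hw] at hD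
  have hM : padicNorm 7 ((-(7 : ℚ)) ^ (-11 + 3 : ℤ) * gHat b 7 x * (-14)) ≤ (7 : ℚ) ^ (-(-11 + 4 : ℤ)) := by
    have hz : ∀ a : ℤ, padicNorm 7 ((-(7 : ℚ)) ^ a) = (7 : ℚ) ^ (-a) := fun a => by
      have h := LevelClass.padicNorm_neg_p_zpow (p := 7) a
      exact_mod_cast h
    rw [padicNorm.mul, padicNorm.mul, hz]
    have h14 : padicNorm 7 (-14 : ℚ) ≤ (7 : ℚ) ^ (-(1 : ℤ)) := by
      exact_mod_cast padicNorm_intCast_le_of_dvd (p := 7) (n := -14) (by norm_num)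
    calc (7 : ℚ) ^ (-(-11 + 3 : ℤ)) * padicNorm 7 (gHat b 7 x) * padicNorm 7 (-14)
        ≤ (7 : ℚ) ^ (-(-11 + 3 : ℤ)) * 1 * (7 : ℚ) ^ (-(1 : ℤ)) :=
          mul_le_mul (mul_le_mul_of_nonneg_left hg1 (by positivity)) h14 (padicNorm.nonneg _) (by positivity)
      _ = (7 : ℚ) ^ (-(-11 + 4 : ℤ)) := by norm_num
  have hsplit : classW b 7 x = (classW b 7 x - (-(7 : ℚ)) ^ (-11 + 3 : ℤ) * gHat b 7 x * (-14)) +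
      (-(7 : ℚ)) ^ (-11 + 3 : ℤ) * gHat b 7 x * (-14) := by ring
  refine val_ge_of_padicNorm_le hne ?_
  rw [hsplit, show (-(-7 : ℤ)) = -(-11 + 4 : ℤ) by norm_num]
  refine (padicNorm.nonarchimedean (p := 7)).trans (max_le ?_ ?_)
  · exact_mod_cast hD
  · exact_mod_cast hM

end Centre

end Summit.KontsevichZagierPeriods.Zeta5Search.KummerOctaveOne

end
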